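import Literature.MathematicalPhysics.QuantumFieldTheory.Balaban1983to89.HaarUnitaryMaximalChart

/-!
# `Balaban1983to89.LogChartPiTwinBridge` — [Balaban1985Averaging] (21)–(25) p. 21 «log U = iA»: THE THREE PRINCIPAL-LOG
# OBJECTS OF `U(N)` IN THE TREE ARE ONE, and (22)–(25) hold AS PRINTED — for EVERY unitary matrix — on the named
# maximal chart inverse `Λ_π = logChartPi`

statement-level skeleton of published theorems with citation tags; proofs where landed; nothing here is a claim
about the Yang–Mills mass gap

Mega-formalization `lit-balaban` (HOME `run/shared/lean/pub/lit-balaban/`), unit `lit-balaban-r20` gen 39 (B12 fold owner /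
DEFINITIONS steward; ruling G.5-1 «keep both, bridge»; TAKING HOME/STATUS 2026-08-23T03:14:30Z).  STEWARD BRIDGE, theorems
only (0 definitions, 0 named facts, 0 sorry).

THE TWINS (DEFINITIONS register pairs H28 / H29).
* H28 — three typings of print's `log U` for `U ∈ U(N)`:
  (a) `HaarDensityUnitaryGlobal.logChartPi U = i·arg U ∈ 𝔲(N)` (unit p28 gen 13, File 5 `HaarUnitaryMaximalChart`: the
      inverse of the exponential chart `Θ` on the MAXIMAL window `‖U − 1‖ < 2`, through Mathlib's continuous functional
      calculus `Unitary.argSelfAdjoint`);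
  (b) the same lineage's gen-10 `HaarExponentialChart.IsChartRep.logChart` (`Λ g = log ρ(g)` = the SERIES logarithm (21)
      `MatrixLog.mlog` on the small window `‖ρ g − 1‖ < innerRadius = 1/3`, `0` outside);
  (c) the pre-cell `MatrixLog.mlog` (21) itself, with `MatrixLog.exists_isHermitian_exp_eq` ((23)–(25) for every unitary
      matrix with an EXISTENTIAL Hermitian `A`) and the C⋆-level (24)–(25) `MatrixLog.unitary_norm_sub_one_le_norm_arg` /
      `unitary_norm_arg_le` (window `‖u − 1‖ < 2`), `ExpMeanLog.mlog_coe_unitary_eq_I_smul_arg` ((21) = (23) on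
      `‖u − 1‖ < 2 ln 2/π`).
  No statement in the tree related (a) to (b) or (c).
* H29 — `HaarDensityUnitaryGlobal.expChartHomeomorph : OpenPartialHomeomorph 𝔲(N) U(N)` (File 5, hand-built) and Mathlib's
  `Unitary.openPartialHomeomorph : OpenPartialHomeomorph (unitary A) (selfAdjoint A)` (any C⋆-algebra; `argSelfAdjoint` /
  `expUnitary` between `ball 1 2` and `ball 0 π`), used inside File 5's proof of `continuousOn_logChartPi` but related to
  `expChartHomeomorph` by no statement.

CITATION HEADER.  [Balaban1985Averaging] T. Bałaban, *Averaging operations for lattice gauge theories*, CMP **98** (1985)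
17–51, p. 21 (held: `paper:balaban1985-cmp98-averaging`, PDF p. 5 L17–L45, re-read 2026-08-23): *«The first is a
logarithmic function. It is an inverse to the exponential function and for matrices X satisfying |X − 1| < 1 it is given
by [the series] (21) … For any branch log z … we may define log X for X defining a normal operator … log X = Σ_j log z_j P_j
(22). We will use this definition for log z = log|z| + i arg z, where arg z ∈ ]−π, π], and for unitary matrices. Every
unitary matrix U can be represented uniquely in the form U = Σ_j e^{iλ_j} P_j, where the numbers λ_j are different and
satisfy λ_j ∈ ]−π, π], and then we define log U = i Σ_j λ_j P_j = iA, (23) A is a hermitian matrix, |A| ≤ π. From this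
definition the following inequalities follow: |U − 1| = max_j |e^{iλ_j} − 1| … ≤ |log U|, (24) |log U| ≤ (π/2)|U − 1|
(25)»*.  [Helgason2000] S. Helgason, *Groups and Geometric Analysis*, Ch. I §1 Thm. 1.14 p. 96 («exp gives a
diffeomorphism of N₀ onto N_e») for §5.

WHAT THIS MODULE PROVES (theorems only; the C⋆-algebra structure of `M_N(ℂ)` under the `L²`-operator norm enters, as in
`MatrixLog` / `HaarDensityUnitaryGlobal` / `HaarUnitaryMaximalChart`, by `letI : CStarAlgebra (Matrix n n ℂ) := {}` inside terms
and proofs — no instance is declared).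
§1 `Λ_π` read in `M_N(ℂ)`: `coe_logChartPi` (`(Λ_π U : M_N(ℂ)) = i·arg U`), `toSelfAdjoint_logChartPi` (`−iΛ_π U = arg U`
   = the `A` of (23)), `norm_logChartPi_eq`.
§2 **(22)–(23) AS PRINTED, FOR EVERY UNITARY MATRIX** (File 5 has them on the window `‖U − 1‖ < 2` only):
   `expUnitary_argSelfAdjoint_unitaryGroup` (`e^{i arg U} = U` for EVERY `U ∈ U(N)`: the spectrum of a matrix is finite,
   so `arg` is continuous on it — the device of `MatrixLog.exists_isHermitian_exp_eq`, here for the named object),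
   **`expChart_logChartPi_of_unitaryGroup`: `Θ(Λ_π U) = U` with NO window hypothesis**, `exp_coe_logChartPi`
   (`e^{Λ_π U} = U` in `M_N(ℂ)`), `norm_logChartPi_le_pi` («|A| ≤ π», all `U`), `leftInverse_expChart_logChartPi`,
   `logChartPi_injective`, `expChart_surjective`, `image_expChart_closedBall_pi` (`Θ(closedBall 0 π) = U(N)`),
   `eq_logChartPi_of_expChart_eq` («represented UNIQUELY»: `‖X‖ < π`, `Θ X = U ⇒ X = Λ_π U`), `logChartPi_one`,
   `logChartPi_eq_zero_iff`.
§3 **(24)–(25) AS PRINTED, FOR EVERY `U ∈ U(N)`**: `norm_sub_one_le_norm_logChartPi` (`‖U − 1‖ ≤ ‖Λ_π U‖`),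
   `norm_logChartPi_le_pi_div_two_mul` (`‖Λ_π U‖ ≤ (π/2)‖U − 1‖`) — `MatrixLog`'s self-adjoint-side (24)/(25) BY NAME + §2; so
   `Λ_π U` is the NAMED witness of `MatrixLog.exists_isHermitian_exp_eq` (`isHermitian_toSelfAdjoint_logChartPi`,
   `exp_I_smul_toSelfAdjoint_logChartPi`, in the cell's `opDist1` letters `opDist1_le_norm_logChartPi` /
   `norm_logChartPi_le_pi_div_two_mul_opDist1`); `norm_logChartPi_lt_pi_iff` (`‖Λ_π U‖ < π ↔ ‖U − 1‖ < 2`: the maximal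
   window in the coordinate), `norm_logChartPi_eq_pi_iff` (`= π ↔ −1 ∈ σ(U)`).
§4 **(21) = (23) — PAIR H28 BRIDGED**: `coe_logChartPi_eq_mlog` (`(Λ_π U : M_N(ℂ)) = mlog U` for `‖U − 1‖ < 2 ln 2/π`,
   `ExpMeanLog.mlog_coe_unitary_eq_I_smul_arg` BY NAME), **`logChartPi_eq_logChart`** (`Λ_π U =
   (isChartRep_unitaryGroup).logChart U` on the gen-10 window `‖U − 1‖ < innerRadius (unitaryLogChart n) = 1/3` — the small
   chart IS the restriction of the maximal one), `logChartPi_eq_logChart_of_mem_window`, and the windows of gens 10–13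
   in the one coordinate:
   **`image_expChart_ball_eq`** (`Θ(B(0,s)) = {U : ‖Λ_π U‖ < s}` for `s ≤ π`), `window_eq_setOf_norm_logChartPi_lt`.
§5 **PAIR H29 BRIDGED**: `expChartHomeomorph_apply_eq` (`expChartHomeomorph X = Unitary.openPartialHomeomorph.symm (−iX)`),
   `expChartHomeomorph_symm_apply_eq` (`= ofSelfAdjoint (Unitary.openPartialHomeomorph U)`), `expChartHomeomorph_target_eq`
   (`= Unitary.openPartialHomeomorph.source`), `expChartHomeomorph_source_eq`
   (`= toSelfAdjoint ⁻¹' Unitary.openPartialHomeomorph.target`).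

HONEST SCOPE.  (i) Nothing of `MatrixLog`, `BlockAveragingExpMeanLog`, `HaarExponentialChart*`, `HaarDensityUnitaryGlobal`,
`HaarUnitaryMaximalChart` or Mathlib is re-proved: every step cites the landed lemma by name; the only argument spelled out
again is the five-line functional-calculus identity `e^{i arg U} = U` on a finite spectrum (as in `MatrixLog`, there hidden
inside an existential).  (ii) `Λ_π` is NOT continuous at `U` with `−1 ∈ σ(U)` (there `‖Λ_π U‖ = π`); §2–§3 are pointwise
statements, continuity stays File 5's `continuousOn_logChartPi` on the window.  (iii) `U(N)` only (closed `G ≤ U(N)`: File 5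
HONEST SCOPE (ii), not filed).  (iv) Nothing here is progress on `Summit.QuantumFields`; the value is that the register's
three `log U` objects and two chart packages are ONE by theorem, and (22)–(25) are certified as printed («every unitary
matrix») on a named object.  Failed printed steps: none (HOME/GAPS.md unchanged).
-/

noncomputable section

open NormedSpace Set Function Filter Topology Complex
open scoped Matrix.Norms.L2Operator

namespace Literature.MathematicalPhysics.QuantumFieldTheory.Balaban1983to89.LogChartPiTwinBridge

open HaarExponentialChart HaarExponentialChart.IsChartRep HaarDensityUnitaryGlobal MatrixLog
open ExpMeanLog (mlog_coe_unitary_eq_I_smul_arg)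
open Literature.MathematicalPhysics.QuantumLattice (unitaryFundamentalRep unitaryFundamentalRep_apply)
open UnitaryModel (opDist1)

variable {n : Type*} [Fintype n] [DecidableEq n]

/-! NOTE ON THE C⋆-STRUCTURE OF `M_N(ℂ)`.  Mathlib registers no global `CStarAlgebra (Matrix n n ℂ)`; the lineage
assembles it from the scoped `L²`-operator-norm instances by `letI : CStarAlgebra (Matrix n n ℂ) := {}` (`MatrixLog`,
`HaarDensityUnitaryGlobal`, `HaarUnitaryMaximalChart`).  Statements below that name Mathlib's `Unitary.argSelfAdjoint` /
`Unitary.openPartialHomeomorph` carry the same `letI` INSIDE the term, so that no instance is declared in this file and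
the terms are syntactically those of File 5's `logChartPi`. -/

/-! ## §1 `Λ_π U = i·arg U` read in `M_N(ℂ)` -/

/-- `(Λ_π U : M_N(ℂ)) = i·arg U` (print's «log U = iA»). [cite: Balaban1985Averaging, (23) p. 21] -/
theorem coe_logChartPi (U : Matrix.unitaryGroup n ℂ) :
    ((logChartPi U : (unitaryLogChart n).lie) : Matrix n n ℂ) =
      I • (((by letI : CStarAlgebra (Matrix n n ℂ) := {}; exact Unitary.argSelfAdjoint U) :
        selfAdjoint (Matrix n n ℂ)) : Matrix n n ℂ) := rfl

/-- `−i·Λ_π U = arg U` — the Hermitian `A` of (23). [cite: Balaban1985Averaging, (23) p. 21] -/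
theorem toSelfAdjoint_logChartPi (U : Matrix.unitaryGroup n ℂ) :
    toSelfAdjoint (logChartPi U) = (by letI : CStarAlgebra (Matrix n n ℂ) := {}; exact Unitary.argSelfAdjoint U) :=
  toSelfAdjoint_ofSelfAdjoint _

/-- `|log U| = |A|`: `‖Λ_π U‖ = ‖arg U‖`. [cite: Balaban1985Averaging, (23) p. 21] -/
theorem norm_logChartPi_eq (U : Matrix.unitaryGroup n ℂ) :
    ‖logChartPi U‖ =
      ‖((by letI : CStarAlgebra (Matrix n n ℂ) := {}; exact Unitary.argSelfAdjoint U) : selfAdjoint (Matrix n n ℂ))‖ := by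
  rw [← toSelfAdjoint_logChartPi, norm_toSelfAdjoint]

/-! ## §2 (22)–(23) AS PRINTED: `e^{log U} = U` and `|A| ≤ π` for EVERY unitary matrix -/

/-- **`e^{i arg U} = U` FOR EVERY `U ∈ U(N)`** — no hypothesis `‖U − 1‖ < 2`: the spectrum of a matrix is finite, so the
principal `arg` is continuous on it and Mathlib's functional-calculus proof of `expUnitary_argSelfAdjoint` runs for every
`U` (print: «EVERY unitary matrix U can be represented … U = Σ_j e^{iλ_j}P_j, λ_j ∈ ]−π, π]»; the device of
`MatrixLog.exists_isHermitian_exp_eq`, there inside an existential). [cite: Balaban1985Averaging, (22)–(23) p. 21] -/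
theorem expUnitary_argSelfAdjoint_unitaryGroup (U : Matrix.unitaryGroup n ℂ) :
    selfAdjoint.expUnitary (by letI : CStarAlgebra (Matrix n n ℂ) := {}; exact Unitary.argSelfAdjoint U) = U := by
  letI : CStarAlgebra (Matrix n n ℂ) := {}
  have hc : ContinuousOn arg (spectrum ℂ (U : Matrix n n ℂ)) := (Matrix.finite_spectrum (U : Matrix n n ℂ)).continuousOn _
  apply Subtype.ext
  rw [selfAdjoint.expUnitary_coe, Unitary.argSelfAdjoint_coe, ← CFC.exp_eq_normedSpace_exp (𝕜 := ℂ),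
    ← cfc_comp_smul .., ← cfc_comp' ..]
  conv_rhs => rw [← cfc_id' ℂ (U : Matrix n n ℂ)]
  refine cfc_congr fun y hy ↦ ?_
  have hy₁ : ‖y‖ = 1 := spectrum.norm_eq_one_of_unitary U.2 hy
  have : I * y.arg = log y :=
    Complex.ext (by simp [log_re, hy₁]) (by simp [log_im])
  simpa [← exp_eq_exp_ℂ, this] using exp_log (by aesop)

/-- **(22)–(23) `Θ(Λ_π U) = U` FOR EVERY `U ∈ U(N)`** — File 5's `expChart_logChartPi` WITHOUT its window hypothesis
`‖U − 1‖ < 2` (at `−1 ∈ σ(U)` the value `λ_j = π` is used, as printed: `λ_j ∈ ]−π, π]`).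
[cite: Balaban1985Averaging, (22)–(23) p. 21] -/
theorem expChart_logChartPi_of_unitaryGroup (U : Matrix.unitaryGroup n ℂ) :
    (isChartRep_unitaryGroup (n := n)).expChart (logChartPi U) = U := by
  rw [expChart_eq_expUnitary, toSelfAdjoint_logChartPi]
  exact expUnitary_argSelfAdjoint_unitaryGroup U

/-- `e^{log U} = U` in `M_N(ℂ)` for every unitary matrix («It is an inverse to the exponential function»).
[cite: Balaban1985Averaging, (22)–(23) p. 21] -/
theorem exp_coe_logChartPi (U : Matrix.unitaryGroup n ℂ) :
    exp ((logChartPi U : (unitaryLogChart n).lie) : Matrix n n ℂ) = (U : Matrix n n ℂ) := by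
  rw [← coe_expChart, expChart_logChartPi_of_unitaryGroup]

/-- **«|A| ≤ π» FOR EVERY `U`**: `‖Λ_π U‖ ≤ π` (File 5 has `< π` on the window; at `−1 ∈ σ(U)` equality holds, §3).
[cite: Balaban1985Averaging, (23) p. 21] -/
theorem norm_logChartPi_le_pi (U : Matrix.unitaryGroup n ℂ) : ‖logChartPi U‖ ≤ Real.pi := by
  letI : CStarAlgebra (Matrix n n ℂ) := {}
  rw [norm_logChartPi_eq]
  exact Unitary.norm_argSelfAdjoint_le_pi U

/-- `Λ_π` is a GLOBAL section of the exponential chart: `Θ ∘ Λ_π = id` on `U(N)`.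
[cite: Balaban1985Averaging, (22)–(23) p. 21] -/
theorem leftInverse_expChart_logChartPi :
    Function.LeftInverse (isChartRep_unitaryGroup (n := n)).expChart logChartPi :=
  expChart_logChartPi_of_unitaryGroup

/-- `Λ_π` is injective on the whole of `U(N)` (a section of `Θ`). [cite: Balaban1985Averaging, (23) p. 21] -/
theorem logChartPi_injective : Function.Injective (logChartPi (n := n)) :=
  leftInverse_expChart_logChartPi.injective

/-- Every unitary matrix is an exponential `e^X`, `X ∈ 𝔲(N)`: `Θ` is surjective.
[cite: Balaban1985Averaging, (22)–(23) p. 21] -/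
theorem expChart_surjective : Function.Surjective (isChartRep_unitaryGroup (n := n)).expChart :=
  leftInverse_expChart_logChartPi.surjective

/-- `Θ(closedBall 0 π) = U(N)`: every unitary matrix is `e^X` with `X ∈ 𝔲(N)`, `‖X‖ ≤ π` («U = e^{iA}, |A| ≤ π»).
[cite: Balaban1985Averaging, (23) p. 21] -/
theorem image_expChart_closedBall_pi :
    (isChartRep_unitaryGroup (n := n)).expChart '' Metric.closedBall (0 : (unitaryLogChart n).lie) Real.pi = Set.univ := by
  refine Set.eq_univ_of_forall fun U => ⟨logChartPi U, ?_, expChart_logChartPi_of_unitaryGroup U⟩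
  rw [mem_closedBall_zero_iff]
  exact norm_logChartPi_le_pi U

/-- `Λ_π 1 = 0` (`log 1 = 0`). [cite: Balaban1985Averaging, (23) p. 21] -/
theorem logChartPi_one : logChartPi (1 : Matrix.unitaryGroup n ℂ) = 0 := by
  have h := logChartPi_expChart (n := n) (X := 0) (by rw [norm_zero]; exact Real.pi_pos)
  rwa [expChart_zero] at h

/-- «represented UNIQUELY … λ_j ∈ ]−π, π]», the uniqueness clause on the open ball: if `X ∈ 𝔲(N)`, `‖X‖ < π` and
`Θ X = U`, then `X = Λ_π U` (File 5 `logChartPi_expChart` read backwards). [cite: Balaban1985Averaging, (23) p. 21] -/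
theorem eq_logChartPi_of_expChart_eq {X : (unitaryLogChart n).lie} {U : Matrix.unitaryGroup n ℂ} (hX : ‖X‖ < Real.pi)
    (h : (isChartRep_unitaryGroup (n := n)).expChart X = U) : X = logChartPi U := by
  rw [← h, logChartPi_expChart hX]

/-- `Λ_π U = 0 ↔ U = 1`. [cite: Balaban1985Averaging, (23) p. 21] -/
theorem logChartPi_eq_zero_iff (U : Matrix.unitaryGroup n ℂ) : logChartPi U = 0 ↔ U = 1 := by
  rw [← logChartPi_one]
  exact logChartPi_injective.eq_iff

/-! ## §3 (24)–(25) AS PRINTED, for EVERY `U ∈ U(N)` -/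

/-- **(24) `|U − 1| ≤ |log U|` FOR EVERY unitary matrix**: `‖U − 1‖ ≤ ‖Λ_π U‖` (`MatrixLog.norm_expUnitary_sub_one_le` — (24)
read on the Lie-algebra side, any C⋆-algebra — at `x = arg U`, and `e^{i arg U} = U` of §2).
[cite: Balaban1985Averaging, (24) p. 21] -/
theorem norm_sub_one_le_norm_logChartPi (U : Matrix.unitaryGroup n ℂ) :
    ‖(U : Matrix n n ℂ) - 1‖ ≤ ‖logChartPi U‖ := by
  letI : CStarAlgebra (Matrix n n ℂ) := {}
  have h := norm_expUnitary_sub_one_le (Unitary.argSelfAdjoint U)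
  rw [expUnitary_argSelfAdjoint_unitaryGroup] at h
  rwa [norm_logChartPi_eq]

/-- **(25) `|log U| ≤ (π/2)|U − 1|` FOR EVERY unitary matrix**: `‖Λ_π U‖ ≤ (π/2)‖U − 1‖`
(`MatrixLog.norm_le_pi_div_two_mul_norm_expUnitary_sub_one` at `x = arg U`, `‖arg U‖ ≤ π`, and §2).
[cite: Balaban1985Averaging, (25) p. 21] -/
theorem norm_logChartPi_le_pi_div_two_mul (U : Matrix.unitaryGroup n ℂ) :
    ‖logChartPi U‖ ≤ Real.pi / 2 * ‖(U : Matrix n n ℂ) - 1‖ := by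
  letI : CStarAlgebra (Matrix n n ℂ) := {}
  have h := norm_le_pi_div_two_mul_norm_expUnitary_sub_one (Unitary.argSelfAdjoint U)
    (Unitary.norm_argSelfAdjoint_le_pi U)
  rw [expUnitary_argSelfAdjoint_unitaryGroup] at h
  rwa [norm_logChartPi_eq]

/-- (24) in the cell's letters `opDist1 U = |U − 1|` (`UnitaryModel`, (19)): `|U − 1| ≤ ‖Λ_π U‖`.
[cite: Balaban1985Averaging, (24) p. 21] -/
theorem opDist1_le_norm_logChartPi (U : Matrix.unitaryGroup n ℂ) : opDist1 (U : Matrix n n ℂ) ≤ ‖logChartPi U‖ :=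
  norm_sub_one_le_norm_logChartPi U

/-- (25) in the cell's letters: `‖Λ_π U‖ ≤ (π/2)|U − 1|`. [cite: Balaban1985Averaging, (25) p. 21] -/
theorem norm_logChartPi_le_pi_div_two_mul_opDist1 (U : Matrix.unitaryGroup n ℂ) :
    ‖logChartPi U‖ ≤ Real.pi / 2 * opDist1 (U : Matrix n n ℂ) :=
  norm_logChartPi_le_pi_div_two_mul U

/-- «A is a hermitian matrix»: `−iΛ_π U` is Hermitian — with `exp_I_smul_toSelfAdjoint_logChartPi`, `norm_logChartPi_le_pi`
and §3 the NAMED witness of `MatrixLog.exists_isHermitian_exp_eq`. [cite: Balaban1985Averaging, (23) p. 21] -/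
theorem isHermitian_toSelfAdjoint_logChartPi (U : Matrix.unitaryGroup n ℂ) :
    ((toSelfAdjoint (logChartPi U) : selfAdjoint (Matrix n n ℂ)) : Matrix n n ℂ).IsHermitian :=
  (toSelfAdjoint (logChartPi U)).2

/-- `exp(i·A) = U` for `A = −iΛ_π U` — the third clause of `MatrixLog.exists_isHermitian_exp_eq` on the named witness.
[cite: Balaban1985Averaging, (22)–(23) p. 21] -/
theorem exp_I_smul_toSelfAdjoint_logChartPi (U : Matrix.unitaryGroup n ℂ) :
    exp (I • ((toSelfAdjoint (logChartPi U) : selfAdjoint (Matrix n n ℂ)) : Matrix n n ℂ)) = (U : Matrix n n ℂ) := by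
  rw [coe_toSelfAdjoint, smul_smul, mul_neg, I_mul_I, neg_neg, one_smul]
  exact exp_coe_logChartPi U

/-- THE MAXIMAL WINDOW IN THE COORDINATE: `‖Λ_π U‖ < π ↔ ‖U − 1‖ < 2` (⇐ File 5 `norm_logChartPi_lt_pi`; ⇒ by (22)–(23):
`U = Θ(Λ_π U) ∈ Θ(B(0,π)) = {‖U − 1‖ < 2}`, File 2 `image_expChart_ball_pi`). [cite: Balaban1985Averaging, (23)–(25) p. 21] -/
theorem norm_logChartPi_lt_pi_iff (U : Matrix.unitaryGroup n ℂ) :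
    ‖logChartPi U‖ < Real.pi ↔ ‖(U : Matrix n n ℂ) - 1‖ < 2 := by
  refine ⟨fun h => ?_, norm_logChartPi_lt_pi⟩
  have hmem : U ∈ (isChartRep_unitaryGroup (n := n)).expChart '' Metric.ball (0 : (unitaryLogChart n).lie) Real.pi :=
    ⟨logChartPi U, mem_ball_zero_iff.2 h, expChart_logChartPi_of_unitaryGroup U⟩
  rw [image_expChart_ball_pi] at hmem
  exact hmem

/-- `‖Λ_π U‖ = π ↔ −1 ∈ σ(U)` (the complementary case: `λ_j = π` for some `j`; File 2 `mem_image_expChart_ball_pi_iff`).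
[cite: Balaban1985Averaging, (23) p. 21] -/
theorem norm_logChartPi_eq_pi_iff (U : Matrix.unitaryGroup n ℂ) :
    ‖logChartPi U‖ = Real.pi ↔ (-1 : ℂ) ∈ spectrum ℂ (U : Matrix n n ℂ) := by
  have hle := norm_logChartPi_le_pi U
  have hiff : ‖logChartPi U‖ < Real.pi ↔ (-1 : ℂ) ∉ spectrum ℂ (U : Matrix n n ℂ) := by
    rw [← mem_image_expChart_ball_pi_iff, image_expChart_ball_pi]
    exact norm_logChartPi_lt_pi_iff U
  constructor
  · intro h
    by_contra hn
    exact absurd (hiff.2 hn) (by rw [h]; exact lt_irrefl _)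
  · intro h
    exact le_antisymm hle (not_lt.1 fun hlt => hiff.1 hlt h)

/-! ## §4 (21) = (23): PAIR H28 — `Λ_π` IS the series logarithm `mlog` and the gen-10 chart `logChart` near `1` -/

/-- `1/3 ≤ 2 ln 2/π` (the gen-10 window of `U(N)` lies inside the domain where (21) = (23) is certified). [folklore] -/
private theorem one_third_le_two_log_two_div_pi : (1 : ℝ) / 3 ≤ 2 * Real.log 2 / Real.pi := by
  rw [le_div_iff₀ Real.pi_pos]
  have := Real.log_two_gt_d9
  have := Real.pi_lt_d2
  nlinarith

/-- `innerRadius (unitaryLogChart n) = 1/3` (`= min ρ (1/2)`, `ρ = 1/3`). [cite: Helgason2000, Ch. I §1 Thm. 1.14 (13) p. 96] -/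
theorem innerRadius_unitaryLogChart : innerRadius (unitaryLogChart n) = 1 / 3 := by
  rw [innerRadius, unitaryLogChart_ρ]
  exact min_eq_left (by norm_num)

/-- **(21) = (23) ON THE NAMED OBJECT**: `(Λ_π U : M_N(ℂ)) = mlog U` — the series logarithm (21) — for `‖U − 1‖ < 2 ln 2/π`
(`ExpMeanLog.mlog_coe_unitary_eq_I_smul_arg` BY NAME). [cite: Balaban1985Averaging, (21)/(23) p. 21] -/
theorem coe_logChartPi_eq_mlog {U : Matrix.unitaryGroup n ℂ} (hU : ‖(U : Matrix n n ℂ) - 1‖ < 2 * Real.log 2 / Real.pi) :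
    ((logChartPi U : (unitaryLogChart n).lie) : Matrix n n ℂ) = mlog (U : Matrix n n ℂ) := by
  letI : CStarAlgebra (Matrix n n ℂ) := {}
  rw [coe_logChartPi]
  exact (mlog_coe_unitary_eq_I_smul_arg (u := U) hU).symm

/-- **PAIR H28 BRIDGED — THE SMALL CHART IS THE RESTRICTION OF THE MAXIMAL ONE**: on the gen-10 window
`‖U − 1‖ < innerRadius (unitaryLogChart n)` (`= 1/3`), `Λ_π U = (isChartRep_unitaryGroup).logChart U` (both sides read in
`M_N(ℂ)` are `mlog U`: `IsChartRep.coe_logChart` and `coe_logChartPi_eq_mlog`).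
[cite: Balaban1985Averaging, (21)/(23) p. 21] [cite: Helgason2000, Ch. I §1 Thm. 1.14 (13) p. 96] -/
theorem logChartPi_eq_logChart {U : Matrix.unitaryGroup n ℂ}
    (hU : ‖(U : Matrix n n ℂ) - 1‖ < innerRadius (unitaryLogChart n)) :
    logChartPi U = (isChartRep_unitaryGroup (n := n)).logChart U := by
  apply Subtype.ext
  have hU' : ‖unitaryFundamentalRep n ℂ U - 1‖ < innerRadius (unitaryLogChart n) := by
    rwa [unitaryFundamentalRep_apply]
  rw [(isChartRep_unitaryGroup (n := n)).coe_logChart hU', unitaryFundamentalRep_apply]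
  refine coe_logChartPi_eq_mlog (hU.trans_le ?_)
  rw [innerRadius_unitaryLogChart]
  exact one_third_le_two_log_two_div_pi

/-- The same on the lineage's windows `V_s = Θ(B(0,s))`, `s ≤ chartRadius`: for `U ∈ V_s`, `Λ_π U = logChart U`
(`IsChartRep.window_eq`). [cite: Helgason2000, Ch. I §1 Thm. 1.14 (13) p. 96] -/
theorem logChartPi_eq_logChart_of_mem_window {s : ℝ} (hs : s ≤ chartRadius (unitaryLogChart n))
    {U : Matrix.unitaryGroup n ℂ} (hU : U ∈ (isChartRep_unitaryGroup (n := n)).window s) :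
    logChartPi U = (isChartRep_unitaryGroup (n := n)).logChart U := by
  rw [(isChartRep_unitaryGroup (n := n)).window_eq hs] at hU
  have h1 : ‖(U : Matrix n n ℂ) - 1‖ < innerRadius (unitaryLogChart n) := by
    have := hU.1
    rwa [unitaryFundamentalRep_apply] at this
  exact logChartPi_eq_logChart h1

/-- **THE WINDOWS IN THE ONE COORDINATE**: for `s ≤ π`, `Θ(B(0,s)) = {U ∈ U(N) : ‖Λ_π U‖ < s}` (⊆: `Λ_π(Θ X) = X` for
`‖X‖ < π`, File 5 `logChartPi_expChart`; ⊇: `U = Θ(Λ_π U)`, §2). [cite: Balaban1985Averaging, (22)–(23) p. 21]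
[cite: Helgason2000, Ch. I §1 Thm. 1.14 (13) p. 96] -/
theorem image_expChart_ball_eq {s : ℝ} (hs : s ≤ Real.pi) :
    (isChartRep_unitaryGroup (n := n)).expChart '' Metric.ball (0 : (unitaryLogChart n).lie) s =
      {U : Matrix.unitaryGroup n ℂ | ‖logChartPi U‖ < s} := by
  ext U
  constructor
  · rintro ⟨X, hX, rfl⟩
    rw [mem_ball_zero_iff] at hX
    show ‖logChartPi ((isChartRep_unitaryGroup (n := n)).expChart X)‖ < s
    rwa [logChartPi_expChart (hX.trans_le hs)]
  · intro hU
    exact ⟨logChartPi U, mem_ball_zero_iff.2 hU, expChart_logChartPi_of_unitaryGroup U⟩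

/-- The gen-10 window `V_s` of `U(N)` is `{‖Λ_π U‖ < s}` for every `s ≤ π` (in particular for `s ≤ chartRadius`, where gens
10–12 state their Haar identities). [cite: Helgason2000, Ch. I §1 Thm. 1.14 (13) p. 96] -/
theorem window_eq_setOf_norm_logChartPi_lt {s : ℝ} (hs : s ≤ Real.pi) :
    (isChartRep_unitaryGroup (n := n)).window s = {U : Matrix.unitaryGroup n ℂ | ‖logChartPi U‖ < s} :=
  image_expChart_ball_eq hs

/-! ## §5 PAIR H29 — `expChartHomeomorph` IS Mathlib's `Unitary.openPartialHomeomorph` read through `X = iH` -/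

/-- `expChartHomeomorph X = (Unitary.openPartialHomeomorph).symm (−iX)` (`Θ X = expUnitary(−iX)`, File 2
`expChart_eq_expUnitary`). [cite: Helgason2000, Ch. I §1 Thm. 1.14 p. 96] [cite: Balaban1985Averaging, (22)–(23) p. 21] -/
theorem expChartHomeomorph_apply_eq (X : (unitaryLogChart n).lie) :
    expChartHomeomorph (n := n) X =
      ((by letI : CStarAlgebra (Matrix n n ℂ) := {}; exact Unitary.openPartialHomeomorph) :
        OpenPartialHomeomorph (unitary (Matrix n n ℂ)) (selfAdjoint (Matrix n n ℂ))).symm (toSelfAdjoint X) := by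
  rw [expChartHomeomorph_apply, expChart_eq_expUnitary]
  rfl

/-- `expChartHomeomorph.symm U = i·(Unitary.openPartialHomeomorph U)` (`= i·arg U = Λ_π U`).
[cite: Helgason2000, Ch. I §1 Thm. 1.14 p. 96] [cite: Balaban1985Averaging, (23) p. 21] -/
theorem expChartHomeomorph_symm_apply_eq (U : Matrix.unitaryGroup n ℂ) :
    (expChartHomeomorph (n := n)).symm U =
      ofSelfAdjoint (((by letI : CStarAlgebra (Matrix n n ℂ) := {}; exact Unitary.openPartialHomeomorph) :
        OpenPartialHomeomorph (unitary (Matrix n n ℂ)) (selfAdjoint (Matrix n n ℂ))) U) := rfl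

/-- `expChartHomeomorph.target = Unitary.openPartialHomeomorph.source` (`= {‖U − 1‖ < 2} = ball 1 2`).
[cite: Helgason2000, Ch. I §1 Thm. 1.14 p. 96] -/
theorem expChartHomeomorph_target_eq :
    (expChartHomeomorph (n := n)).target =
      ((by letI : CStarAlgebra (Matrix n n ℂ) := {}; exact Unitary.openPartialHomeomorph) :
        OpenPartialHomeomorph (unitary (Matrix n n ℂ)) (selfAdjoint (Matrix n n ℂ))).source := by
  letI : CStarAlgebra (Matrix n n ℂ) := {}
  rw [expChartHomeomorph_target, Unitary.openPartialHomeomorph_source]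
  ext U
  rw [Set.mem_setOf_eq, Metric.mem_ball, Subtype.dist_eq, dist_eq_norm]
  rfl

/-- `expChartHomeomorph.source = (X ↦ −iX)⁻¹(Unitary.openPartialHomeomorph.target)` (`= ball 0 π`, `‖−iX‖ = ‖X‖`).
[cite: Helgason2000, Ch. I §1 Thm. 1.14 p. 96] -/
theorem expChartHomeomorph_source_eq :
    (expChartHomeomorph (n := n)).source =
      toSelfAdjoint ⁻¹' ((by letI : CStarAlgebra (Matrix n n ℂ) := {}; exact Unitary.openPartialHomeomorph) :
        OpenPartialHomeomorph (unitary (Matrix n n ℂ)) (selfAdjoint (Matrix n n ℂ))).target := by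
  letI : CStarAlgebra (Matrix n n ℂ) := {}
  rw [expChartHomeomorph_source, Unitary.openPartialHomeomorph_target]
  ext X
  rw [Set.mem_preimage, mem_ball_zero_iff, mem_ball_zero_iff, norm_toSelfAdjoint]

end Literature.MathematicalPhysics.QuantumFieldTheory.Balaban1983to89.LogChartPiTwinBridge
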